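import Summits.QuantumFields.YangMills.Theses.LimitSetRigidity

/-!
# LINE 3 (ideator ym-r3-idea-1 g5) — DOMINANCE / bookkeeping for route `LimitSetRigidity` (answer to critic V77 price (2)).

Both cruxes of the route are CONSEQUENCES of the R3 leaf (weakest-unknown-consequence shape, used toward the leaf by `closes`):
`YM3TorusSU2 → SlowVariationL` and `YM3TorusSU2 → IsolatedLimitPointsL`, sorry-free.  Hence every route whose cone proves the leaf
(UnitScaleTilt with h200 ∧ h201 ∧ HistoryTailL, ReplicaVarianceTilt, UVClassRigidity, …) dominates both cruxes THROUGH THE LEAF.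
Correction of record: `UnitScaleTilt.HistoryTailL` (stmt-QuantumFields-19936) ALONE does not give `SlowVariationL` — it bounds the Gibbs
mass of large-field HISTORIES (summably), and says nothing about the small-field agreement of runs K and K+1 (that is h200/h201); the
dominance «27352 below 19936» holds only together with the tilt cruxes, i.e. through the leaf.  A turnkey/prover may land these two
theorems under `Theorems/` with `--supports stmt-QuantumFields-27352` / `--supports stmt-QuantumFields-27351` (they close nothing: the
hypothesis is the open leaf).  No summit, rung or crux is proved here.
-/

namespace Summit.QuantumFields.YangMills.Theses.LimitSetRigidity

namespace Cruxes.Dominance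

open Filter Topology Literature.MathematicalPhysics.QuantumFieldTheory.Balaban1983to89
  Literature.MathematicalPhysics.QuantumFieldTheory.Balaban1983to89.T3ContinuumYM3Torus
  Literature.MathematicalPhysics.QuantumFieldTheory.Balaban1983to89.T3UnitLawDensityEML
  Literature.MathematicalPhysics.QuantumFieldTheory.Balaban1983to89.Missing

/-- The leaf implies crux A: a convergent sequence has consecutive differences → 0. -/
theorem slowVariationL_of_leaf
    (h : Literature.MathematicalPhysics.QuantumFieldTheory.Balaban1983to89.T3YM3TorusStatement.YM3TorusSU2) :
    Summit.QuantumFields.YangMills.Theses.LimitSetRigidity.SlowVariationL := by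
  obtain ⟨γ₁, hγ₁, hS⟩ := h
  refine ⟨γ₁, hγ₁, fun F γ hγ hγle Cs => ?_⟩
  have hC : HasContinuumLimit (F.scheme ℰp γ) :=
    (continuumYM3Torus_iff_hasContinuumLimit_SU F ℰp measurableE_ℰp hγ.le).mp (hS F γ hγ hγle)
  obtain ⟨l, hl⟩ := hC Cs
  have h1 : Tendsto (fun K : ℕ => (F.scheme ℰp γ).expectAt (K + 1) Cs) atTop (𝓝 l) :=
    hl.comp (tendsto_add_atTop_nat 1)
  have := h1.sub hl
  simpa using this

/-- The leaf implies crux B (with `T := ∅`): under uniqueness of limit points any two subsequential limit functionals coincide. -/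
theorem isolatedLimitPointsL_of_leaf
    (h : Literature.MathematicalPhysics.QuantumFieldTheory.Balaban1983to89.T3YM3TorusStatement.YM3TorusSU2) :
    Summit.QuantumFields.YangMills.Theses.LimitSetRigidity.IsolatedLimitPointsL := by
  obtain ⟨γ₁, hγ₁, hS⟩ := h
  refine ⟨γ₁, hγ₁, fun F γ hγ hγle => ⟨∅, 1, one_pos, ?_⟩⟩
  intro φ ψ E E' hφ hψ hE hE' _
  have hU : HasUniqueLimitPoints (F.scheme ℰp γ) :=
    (continuumYM3Torus_iff_hasUniqueLimitPoints_SU F ℰp measurableE_ℰp hγ.le).mp (hS F γ hγ hγle)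
  funext Cs
  exact hU Cs φ ψ hφ hψ (E Cs) (E' Cs) (hE Cs) (hE' Cs)

end Cruxes.Dominance

end Summit.QuantumFields.YangMills.Theses.LimitSetRigidity
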